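import Mathlib

/-!
# `MatrixDescartes`, line `Lift` — negative lemma: the threshold `K₀` and the size bound of the hard stub `OneIndefiniteDescartes` are load-bearing

Line `Lift` of crux `stmt-ValiantsHypothesis-18050` (`Cruxes/MatrixDescartes/Lines/Lift.lean`, lead
`prover-line-stmt-ValiantsHypothesis-18050-0`) reduces `MatrixDescartes` to its restriction C⁺ =
`OneIndefiniteDescartes` to pencils `X^e • J + ∑ₖ X^{dₖ} • Pₖ` with ONE constant real symmetric `J` and
positive semidefinite `Pₖ` (`K = card κ` PSD terms, size `card ι ≤ 2^((⌊log₂K⌋+c)^c)`, bound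
`Z^q ≤ 2^(K⌊log₂K⌋)`).  The PSD restriction does not tame the smallest formats: with `J = −diag(1,…,n)`
and a SINGLE PSD term `P = I` the pencil is `diag(X − 1, …, X − n)` with `Z = n` (`card_roots_JW`; the
same diagonal witness as `…Negative.MatrixDescartesLoadBearing`, rebuilt here in the stub's shape).  Hence

* `oneIndefinite_false_without_eventually` — C⁺ with `∃ K₀` deleted is false already at `K = 1`
  (`c = 2`, `n = 5 ≤ 2^4`, bound `2^(1·0) = 1 < 5`): the lead's `K₀` (in the glue: `max K₀' 4`) is
  load-bearing, exactly as for the crux (`matrixDescartes_false_without_eventually`);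
* `oneIndefinite_false_without_sizeBound` — C⁺ with the size hypothesis deleted is false (pad with zero
  PSD terms to reach any `K ≥ K₀`, take `n = 2^(K⌊log₂K⌋) + 1`).

Stated over the stub's own quantifier shape (arbitrary `Fintype` index types), self-contained (the
line file carries a `sorry` and is not imported). [folklore]
-/

-- `Summit.ValiantsHypothesis.ValiantsHypothesis.…` repeats a component by the D-0017 layout
-- (single-conjunct summit), which the `dupNamespace` linter flags; the name is mandated.
set_option linter.dupNamespace false

namespace Summit.ValiantsHypothesis.ValiantsHypothesis.Theorems.MatrixDescartes.Negative

open scoped BigOperators Matrix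
open Polynomial

/-- C⁺ of line `Lift` (verbatim shape of `Lines/Lift.lean: OneIndefiniteDescartes`) with the
threshold `∃ K₀, K₀ ≤ card κ → …` deleted. -/
def OneIndefiniteDescartesWithoutEventually : Prop :=
  ∀ c q : ℕ, 0 < q → ∀ (ι κ : Type) [Fintype ι] [DecidableEq ι] [Fintype κ],
    Fintype.card ι ≤ 2 ^ ((Nat.log 2 (Fintype.card κ) + c) ^ c) →
    ∀ (e : ℕ) (d : κ → ℕ) (J : Matrix ι ι ℝ) (P : κ → Matrix ι ι ℝ),
      J.IsSymm → (∀ k, (P k).PosSemidef) →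
      (Matrix.det (((Polynomial.X : Polynomial ℝ) ^ e) • J.map Polynomial.C
          + ∑ k, ((Polynomial.X : Polynomial ℝ) ^ d k) • (P k).map Polynomial.C)).roots.toFinset.card ^ q
        ≤ 2 ^ (Fintype.card κ * Nat.log 2 (Fintype.card κ))

/-- C⁺ of line `Lift` with the size hypothesis `card ι ≤ 2^((⌊log₂ card κ⌋+c)^c)` deleted. -/
def OneIndefiniteDescartesWithoutSizeBound : Prop :=
  ∀ q : ℕ, 0 < q → ∃ K₀ : ℕ, ∀ (ι κ : Type) [Fintype ι] [DecidableEq ι] [Fintype κ],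
    K₀ ≤ Fintype.card κ →
    ∀ (e : ℕ) (d : κ → ℕ) (J : Matrix ι ι ℝ) (P : κ → Matrix ι ι ℝ),
      J.IsSymm → (∀ k, (P k).PosSemidef) →
      (Matrix.det (((Polynomial.X : Polynomial ℝ) ^ e) • J.map Polynomial.C
          + ∑ k, ((Polynomial.X : Polynomial ℝ) ^ d k) • (P k).map Polynomial.C)).roots.toFinset.card ^ q
        ≤ 2 ^ (Fintype.card κ * Nat.log 2 (Fintype.card κ))

/-! ## The witness `J = −diag(1,…,n)`, `P₀ = I`, other `Pₖ = 0` -/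

/-- the indefinite constant coefficient -/
noncomputable def JW (n : ℕ) : Matrix (Fin n) (Fin n) ℝ :=
  Matrix.diagonal fun i : Fin n => -(((i : ℕ) : ℝ) + 1)

/-- the PSD coefficients: the identity at index `0`, zero elsewhere (`K + 1` terms) -/
noncomputable def PW (n K : ℕ) : Fin (K + 1) → Matrix (Fin n) (Fin n) ℝ :=
  Fin.cons 1 fun _ => 0

/-- their exponents: `1` at index `0`, `0` elsewhere -/
def eW (K : ℕ) : Fin (K + 1) → ℕ :=
  Fin.cons 1 fun _ => 0

/-- `J` is symmetric -/
theorem JW_isSymm (n : ℕ) : (JW n).IsSymm :=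
  Matrix.isSymm_diagonal _

/-- every `Pₖ` is positive semidefinite -/
theorem PW_posSemidef (n K : ℕ) (k : Fin (K + 1)) : (PW n K k).PosSemidef := by
  refine Fin.cases ?_ (fun k => ?_) k
  · simp only [PW, Fin.cons_zero]
    exact Matrix.PosSemidef.one
  · simp only [PW, Fin.cons_succ]
    exact Matrix.PosSemidef.zero

/-- the witness pencil is `diag(X − 1, …, X − n)` -/
theorem pencil_JW (n K : ℕ) :
    ((Polynomial.X : Polynomial ℝ) ^ 0) • (JW n).map Polynomial.C
        + ∑ k, ((Polynomial.X : Polynomial ℝ) ^ eW K k) • (PW n K k).map Polynomial.C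
      = Matrix.diagonal fun i : Fin n => X - Polynomial.C (((i : ℕ) : ℝ) + 1) := by
  rw [Fin.sum_univ_succ]
  have h0 : ∀ x : Fin K,
      (X : ℝ[X]) ^ eW K x.succ • (PW n K x.succ).map Polynomial.C = 0 := by
    intro x
    simp only [PW, Fin.cons_succ, Matrix.map_zero Polynomial.C (map_zero Polynomial.C), smul_zero]
  simp only [h0, Finset.sum_const_zero, add_zero]
  simp only [eW, PW, JW, Fin.cons_zero, pow_one, pow_zero, one_smul]
  rw [Matrix.map_one Polynomial.C (map_zero _) (map_one _),
    Matrix.diagonal_map (map_zero Polynomial.C), Matrix.smul_one_eq_diagonal, Matrix.diagonal_add]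
  congr 1
  funext i
  simp [sub_eq_add_neg, add_comm]

/-- the witness has exactly `n` distinct real zeros -/
theorem card_roots_JW (n K : ℕ) :
    (Matrix.det (((Polynomial.X : Polynomial ℝ) ^ 0) • (JW n).map Polynomial.C
        + ∑ k, ((Polynomial.X : Polynomial ℝ) ^ eW K k) • (PW n K k).map Polynomial.C)
      ).roots.toFinset.card = n := by
  rw [pencil_JW, Matrix.det_diagonal]
  have hinj : Function.Injective (fun i : Fin n => ((i : ℕ) : ℝ) + 1) := by
    intro i j h
    have h' : ((i : ℕ) : ℝ) = ((j : ℕ) : ℝ) := add_right_cancel h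
    exact Fin.ext (Nat.cast_injective h')
  have hprod : (∏ i : Fin n, (X - Polynomial.C (((i : ℕ) : ℝ) + 1)))
      = ∏ a ∈ (Finset.univ.image fun i : Fin n => ((i : ℕ) : ℝ) + 1), (X - Polynomial.C a) := by
    rw [Finset.prod_image (fun x _ y _ h => hinj h)]
  rw [hprod, Polynomial.roots_prod_X_sub_C, Finset.val_toFinset,
    Finset.card_image_of_injective _ hinj, Finset.card_univ, Fintype.card_fin]

/-- **`K₀` is load-bearing for C⁺**: at `K = 1` the bound reads `Z ≤ 1`, but `J = −diag(1,…,5)`,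
`P = I` give `Z = 5` at admissible size (`c = 2`: `5 ≤ 2^((0+2)^2)`). [folklore] -/
theorem oneIndefinite_false_without_eventually : ¬ OneIndefiniteDescartesWithoutEventually := by
  intro h
  have hlog : Nat.log 2 (Fintype.card (Fin (0 + 1))) = 0 := by simp
  have h1 := h 2 1 one_pos (Fin 5) (Fin (0 + 1)) (by rw [hlog]; simp) 0 (eW 0) (JW 5) (PW 5 0)
    (JW_isSymm 5) (PW_posSemidef 5 0)
  rw [card_roots_JW, pow_one, hlog] at h1
  simp at h1

/-- **The size bound is load-bearing for C⁺**: pad with zero PSD terms to `K = K₀ + 1` terms and take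
`n = 2^(K⌊log₂K⌋) + 1`. [folklore] -/
theorem oneIndefinite_false_without_sizeBound : ¬ OneIndefiniteDescartesWithoutSizeBound := by
  intro h
  obtain ⟨K₀, hK⟩ := h 1 one_pos
  obtain ⟨E, hE⟩ : ∃ E, Fintype.card (Fin (K₀ + 1)) * Nat.log 2 (Fintype.card (Fin (K₀ + 1))) = E :=
    ⟨_, rfl⟩
  have h1 := hK (Fin (2 ^ E + 1)) (Fin (K₀ + 1)) (by simp) 0 (eW K₀) (JW _) (PW _ K₀)
    (JW_isSymm _) (PW_posSemidef _ K₀)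
  rw [card_roots_JW, pow_one, hE] at h1
  omega

end Summit.ValiantsHypothesis.ValiantsHypothesis.Theorems.MatrixDescartes.Negative
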